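import Mathlib.Algebra.Polynomial.Eval.Defs
import Mathlib.Data.Nat.Size
import Literature.Computability.Complexity.PPolyReductions
import Literature.Computability.Complexity.KarpProblemsProofs
import Literature.Computability.Complexity.CircuitClassesProofs
import Literature.Computability.Complexity.TM2PassThrough
import Literature.Computability.Complexity.DeMorganSimulation
import Literature.Computability.Complexity.GraphEncodings
import Literature.Computability.Complexity.ConstantDepth
import Literature.Computability.Complexity.TC0SubsetNC1
import Literature.Computability.Complexity.CircuitLowerBounds
import HarnessLib

/-!
# Hamiltonicity: matrix-input circuits versus the string language — `NP ⊆ P/poly` iff HAM has small matrix circuits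

Two presentations of "Hamiltonicity has polynomial-size circuits" are used in the tree: the
string language `HAMCIRCUIT ∈ P/poly` (`KarpProblems.lean`, `CircuitClasses.lean`: `B₂`-circuit
families indexed by the input LENGTH, deciding membership of arbitrary strings) and, in the routes
on symmetric circuits (`Summits/PneNP/PneNP/Theses/SymmetryBudget.lean` and its crux files), circuit
families indexed by the NUMBER OF VERTICES `m`, reading the `m × m` Boolean matrix `x` and
computing `HAM_m x = [SimpleGraph.fromRel (x · · = true) is Hamiltonian]` over the threshold basis
`tcBasis`, size = number of gates (majority gates of arbitrary fan-in, repeated wires allowed).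
This file proves that the two coincide, and hence (Karp: `HAMILTON CIRCUIT` is NP-complete,
`isNPComplete_HAMCIRCUIT_holds`; `P/poly` is closed under Karp reductions,
`NP_subset_PPoly_iff_of_isNPComplete`) that BOTH are equivalent to `NP ⊆ P/poly`:

* `HamMatrix.polySize_B2_of_mem_PPoly`, `HamMatrix.polySize_tcBasis_of_polySize_B2` — string
  circuits give matrix circuits: hard-wire the header `⟨binary m, …⟩` of the code
  (`encodingGraph_encode`: `boolPair (encodeNat m) (adjacency bits)`), read the adjacency block off
  the matrix (one `∨₂` per off-diagonal entry, symmetrising as `encodingGraphFin` does), run the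
  string circuit of length `codeLen m`; `{∧₂, ∨₂, ¬} ⊆ tcBasis` by Jukna's `12 s + 3` simulation.
* `HamMatrix.polySizeLin_B2_of_polySize_tcBasis` — matrix threshold circuits with few GATES give
  `B₂`-circuits with few gates: the size half of `TC⁰ ⊆ NC¹` (`Circuit.acRealOver_B2_of_tcBasis_of_gadget`
  with the Muroga–Håstad weight bound and carry-save addition, `ncVec_threshold_logDepth`,
  `threshold_gadget_size_bound`); this is where unbounded multiplicities are paid for.
* `HamMatrix.mem_PPoly_of_polySizeLin_B2` — matrix circuits give string circuits: at length
  `codeLen m` (the code length of every `m`-vertex graph; `codeLen` is strictly monotone) the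
  circuit checks that its input IS a code with the header of `m` (fixed header bits, symmetric
  adjacency block, empty diagonal — `HamMatrix.valid`; valid vectors are exactly the codes,
  `HamMatrix.valid_encode` / `HamMatrix.encode_mat_of_valid`) and runs the matrix circuit on the
  block; at other lengths no string is a code and the circuit is the constant `0`.
* `HamMatrix.mem_PPoly_iff_polySize_tcBasis`, `HamMatrix.mem_PPoly_iff_polySize_B2`,
  `HamMatrix.np_subset_PPoly_iff_polySize_tcBasis`, `HamMatrix.np_subset_PPoly_iff_matrixCircuits`
  — the summary equivalences.

All of this is representation-independence folklore (Arora–Barak 2009, §0.1 "Representing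
objects as strings", Def. 6.5, §6.4); it is written out because the symmetric-circuit cruxes
(`WindowHam`, `HamCompiles` of route `SymmetryBudget`) are stated on matrices while the summit's
conjecture leaf `NPNotSubsetPPoly` is a statement about string languages. Everything is proved; no
named facts. Deliberately NOT here: depth bookkeeping (the simulations are size-only), other graph
languages (the same three steps work verbatim for any property of `encodingGraph`-coded graphs).

## References

* S. Arora, B. Barak, *Computational Complexity: A Modern Approach*, CUP 2009, §0.1, Def. 6.1–6.5,
  §6.4 [AroraBarak2009].
* R. M. Karp, *Reducibility among combinatorial problems* (1972), §4, Main Theorem, problem 10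
  [Karp1972].
* H. Vollmer, *Introduction to Circuit Complexity* (1999), Thm. 1.20, Thm. 1.24, §4.5.2 [Vollmer1999];
  S. Jukna, *Boolean Function Complexity* (2012), §1.2 [Jukna2012].
-/

namespace Literature.Computability.Complexity

namespace HamMatrix

open _root_.Computability Polynomial

open scoped Classical in
/-- `HAM_m`: Hamiltonicity of the simple graph read off an `m × m` Boolean matrix (symmetrised,
loops dropped — the decoding convention of `encodingGraphFin`), as a Boolean function; the target
function of the route `PneNP/SymmetryBudget`. [folklore] -/
noncomputable def hamFn (m : ℕ) : (Fin m × Fin m → Bool) → Bool :=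
  fun x => decide (SimpleGraph.fromRel fun u v => x (u, v) = true : SimpleGraph (Fin m)).IsHamiltonian

/-- The simple graph of a Boolean matrix (route convention). [folklore] -/
abbrev grOf (m : ℕ) (x : Fin m × Fin m → Bool) : SimpleGraph (Fin m) :=
  SimpleGraph.fromRel fun u v => x (u, v) = true

/-- "HAM has polynomial-size matrix-input circuits over the basis `B`": one polynomial `p` and,
at every `m`, a `B`-circuit on the `m²` matrix entries with at most `p m` gates computing
`HAM_m`. [folklore] -/
def PolySize (B : Set GateFn) : Prop :=
  ∃ p : Polynomial ℕ, ∀ m : ℕ, ∃ C : Circuit (Fin m × Fin m),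
    C.IsOver B ∧ C.size ≤ p.eval m ∧ C.Computes (hamFn m)

/-! ### The code of an `m`-vertex graph: header and adjacency block -/

/-- The header of the code of an `m`-vertex graph: the doubled binary digits of `m` and the
separator `01` (the first component of `boolPair`). [cite: AroraBarak2009, §0.1] -/
def hdr (m : ℕ) : List Bool := ((encodeNat m).flatMap fun b => [b, b]) ++ [false, true]

/-- Length of the header. [folklore] -/
theorem length_hdr (m : ℕ) : (hdr m).length = 2 * (encodeNat m).length + 2 := by
  simp only [hdr, List.length_append, List.length_flatMap, List.length_cons, List.length_nil]
  induction encodeNat m with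
  | nil => simp
  | cons b l ih => simp [List.sum_cons]; omega

/-- The length of the code of every `m`-vertex graph. [folklore] -/
def codeLen (m : ℕ) : ℕ := (hdr m).length + m * m

open scoped Classical in
/-- The adjacency block of the code of `G`: bit `finProdFinEquiv (i, j)` is `[G.Adj i j]`.
[cite: AroraBarak2009, §0.1] -/
noncomputable def adjBlock {m : ℕ} (G : SimpleGraph (Fin m)) : Fin (m * m) → Bool :=
  fun k => decide (G.Adj (finProdFinEquiv.symm k).1 (finProdFinEquiv.symm k).2)

/-- The code of `⟨m, G⟩` is the header followed by the adjacency block. [cite: AroraBarak2009, §0.1] -/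
theorem encode_eq (m : ℕ) (G : SimpleGraph (Fin m)) :
    encodingGraph.encode ⟨m, G⟩ = hdr m ++ List.ofFn (adjBlock G) := by
  rw [encodingGraph_encode]
  rfl

/-- Every `m`-vertex graph has a code of length `codeLen m`. [folklore] -/
theorem length_encode (m : ℕ) (G : SimpleGraph (Fin m)) :
    (encodingGraph.encode ⟨m, G⟩).length = codeLen m := by
  rw [encode_eq, List.length_append, List.length_ofFn, codeLen]

/-- `codeLen m ≤ m² + 2m + 4`. [folklore] -/
theorem codeLen_le (m : ℕ) : codeLen m ≤ m * m + 2 * m + 4 := by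
  have := TM2Pass.length_encodeNat_le_self m
  rw [codeLen, length_hdr]
  omega

/-- `m ≤ codeLen m`. [folklore] -/
theorem le_codeLen (m : ℕ) : m ≤ codeLen m := by
  rw [codeLen]
  rcases Nat.eq_zero_or_pos m with rfl | hm
  · exact Nat.zero_le _
  · exact le_add_left (Nat.le_mul_of_pos_right m hm)

/-- `codeLen` is strictly monotone (so the length of a code determines the number of vertices).
[folklore] -/
theorem codeLen_strictMono : StrictMono codeLen := by
  refine strictMono_nat_of_lt_succ fun m => ?_
  have h1 : (encodeNat m).length ≤ (encodeNat (m + 1)).length := by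
    rw [TM2Pass.length_encodeNat_eq_size, TM2Pass.length_encodeNat_eq_size]
    exact Nat.size_le_size (Nat.le_succ m)
  simp only [codeLen, length_hdr]
  nlinarith

/-- The adjacency bit of the matrix graph at position `(u, v)`: off-diagonal symmetrised entry.
[folklore] -/
theorem adjBlock_grOf {m : ℕ} (x : Fin m × Fin m → Bool) (k : Fin (m * m)) :
    adjBlock (grOf m x) k =
      (if (finProdFinEquiv.symm k).1 = (finProdFinEquiv.symm k).2 then false
       else (x (finProdFinEquiv.symm k) || x ((finProdFinEquiv.symm k).2, (finProdFinEquiv.symm k).1))) := by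
  unfold adjBlock
  set u := (finProdFinEquiv.symm k).1
  set v := (finProdFinEquiv.symm k).2
  by_cases huv : u = v
  · rw [if_pos huv, decide_eq_false_iff_not]
    intro h
    exact h.ne huv
  · rw [if_neg huv]
    have hk : finProdFinEquiv.symm k = (u, v) := rfl
    rw [hk]
    by_cases h1 : x (u, v) = true
    · simp [SimpleGraph.fromRel_adj, huv, h1]
    · by_cases h2 : x (v, u) = true
      · simp [SimpleGraph.fromRel_adj, huv, h2]
      · simp [SimpleGraph.fromRel_adj, h1, h2]

/-! ### From string circuits to matrix circuits -/

/-- Bit `j` of the code of the matrix graph of `x`, as an explicit function of `x`: a header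
constant, or an off-diagonal symmetrised entry, or the constant `0` on the diagonal. [folklore] -/
noncomputable def codeBit (m : ℕ) (j : Fin (codeLen m)) (x : Fin m × Fin m → Bool) : Bool :=
  if h : (j : ℕ) < (hdr m).length then (hdr m)[(j : ℕ)]'h
  else adjBlock (grOf m x) ⟨(j : ℕ) - (hdr m).length, by
    have hj : (j : ℕ) < (hdr m).length + m * m := j.2
    omega⟩

/-- `codeBit` is bit `j` of the code. [folklore] -/
theorem codeBit_eq_getElem (m : ℕ) (j : Fin (codeLen m)) (x : Fin m × Fin m → Bool) :
    codeBit m j x = (encodingGraph.encode ⟨m, grOf m x⟩)[(j : ℕ)]'(by rw [length_encode]; exact j.2) := by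
  simp only [codeBit, encode_eq, List.getElem_append, List.getElem_ofFn]

/-- Each code bit costs at most one `B₂` gate. [folklore] -/
theorem cktSize_codeBit (m : ℕ) (j : Fin (codeLen m)) :
    CktSize B2 (fun (x : Fin m × Fin m → Bool) (_ : Unit) => codeBit m j x) 1 := by
  unfold codeBit
  split_ifs with h
  · exact cktSize_const _ _
  · set k : Fin (m * m) := ⟨(j : ℕ) - (hdr m).length, _⟩
    by_cases huv : (finProdFinEquiv.symm k).1 = (finProdFinEquiv.symm k).2
    · refine (cktSize_const _ false).congr fun x _ => ?_
      rw [adjBlock_grOf, if_pos huv]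
    · refine (cktSize_or (finProdFinEquiv.symm k)
        ((finProdFinEquiv.symm k).2, (finProdFinEquiv.symm k).1)).congr fun x _ => ?_
      rw [adjBlock_grOf, if_neg huv]

/-- All code bits together: `codeLen m` gates. [folklore] -/
theorem cktSize_codeBits (m : ℕ) :
    CktSize B2 (fun (x : Fin m × Fin m → Bool) (j : Fin (codeLen m)) => codeBit m j x) (codeLen m) := by
  have h := CktSize.pi_const (B := B2) (κ := Fin (codeLen m))
    (f := fun (x : Fin m × Fin m → Bool) (j : Fin (codeLen m)) => codeBit m j x) (s := 1)
    (fun j => cktSize_codeBit m j)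
  simpa using h

/-- Evaluating a family at a vector presented with a cast length. [folklore] -/
theorem eval_family_cast (D : CircuitFamily) (s : List Bool) {N : ℕ} (h : s.length = N) :
    (D N).eval (fun j : Fin N => s[(j : ℕ)]'(by rw [h]; exact j.2)) = (D s.length).eval s.get := by
  subst h
  rfl

open scoped Classical in
/-- The value of `HAMCIRCUIT.boolIndicator` at the code of the matrix graph is `HAM_m x`.
[cite: Karp1972, §4 Main Theorem problem 10] -/
theorem boolIndicator_encode (m : ℕ) (x : Fin m × Fin m → Bool) :
    HAMCIRCUIT.boolIndicator (encodingGraph.encode ⟨m, grOf m x⟩) = hamFn m x := by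
  have hiff : encodingGraph.encode ⟨m, grOf m x⟩ ∈ HAMCIRCUIT ↔ (grOf m x).IsHamiltonian :=
    encodingGraph.mem_toLanguage_iff _ _
  unfold hamFn
  by_cases hH : (grOf m x).IsHamiltonian
  · rw [show HAMCIRCUIT.boolIndicator (encodingGraph.encode ⟨m, grOf m x⟩) = true from
      (Set.mem_iff_boolIndicator _ _).1 (hiff.2 hH)]
    exact (decide_eq_true hH).symm
  · have h1 : HAMCIRCUIT.boolIndicator (encodingGraph.encode ⟨m, grOf m x⟩) ≠ true :=
      fun h => hH (hiff.1 ((Set.mem_iff_boolIndicator _ _).2 h))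
    rw [Bool.eq_false_iff.2 h1]
    exact (decide_eq_false hH).symm

/-- The constant-`0` gate is the arity-`0` disjunction, a gate of `tcBasis`. [folklore] -/
theorem const_false_mem_tcBasis : (⟨0, fun _ => false⟩ : GateFn) ∈ tcBasis := by
  have : (⟨0, fun _ => false⟩ : GateFn) = GateFn.or 0 := by
    simp only [GateFn.or]
    exact Sigma.ext rfl (heq_of_eq (funext fun v => by simp))
  rw [this]
  exact acBasis_subset_tcBasis (Or.inr (Set.mem_iUnion.2 ⟨0, Or.inr rfl⟩))

/-- `{∧₂, ∨₂, ¬} ⊆ tcBasis`. [folklore] -/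
theorem deMorganBasis_subset_tcBasis : deMorganBasis ⊆ tcBasis := by
  intro f hf
  simp only [deMorganBasis, Set.mem_insert_iff, Set.mem_singleton_iff] at hf
  refine acBasis_subset_tcBasis ?_
  rcases hf with rfl | rfl | rfl
  · exact Or.inr (Set.mem_iUnion.2 ⟨2, Or.inl rfl⟩)
  · exact Or.inr (Set.mem_iUnion.2 ⟨2, Or.inr rfl⟩)
  · exact Or.inl rfl

/-- `HAM_0 ≡ false` (the graph on no vertices is not Hamiltonian in Mathlib). [folklore] -/
theorem hamFn_zero (x : Fin 0 × Fin 0 → Bool) : hamFn 0 x = false := by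
  unfold hamFn
  rw [decide_eq_false_iff_not]
  intro h
  obtain ⟨a, -⟩ := h (by simp)
  exact a.elim0

/-- The constant-`b` gate is in `B₂`. [folklore] -/
theorem const_gate_mem_B2 (b : Bool) : (⟨0, fun _ => b⟩ : GateFn) ∈ B2 := by
  show (0 : ℕ) ≤ 2
  omega

/-- The constant circuit is over `B₂` and over `tcBasis`. [folklore] -/
theorem const_isOver_B2 (ι : Type*) (b : Bool) : (Circuit.const ι b).IsOver B2 := by
  intro g hg
  simp only [Circuit.const, List.mem_singleton] at hg
  subst hg
  exact const_gate_mem_B2 b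

/-- The constant-`true` gate is the arity-`0` conjunction, a gate of `tcBasis`. [folklore] -/
theorem const_true_mem_tcBasis : (⟨0, fun _ => true⟩ : GateFn) ∈ tcBasis := by
  have : (⟨0, fun _ => true⟩ : GateFn) = GateFn.and 0 := by
    simp only [GateFn.and]
    exact Sigma.ext rfl (heq_of_eq (funext fun v => by simp))
  rw [this]
  exact acBasis_subset_tcBasis (Or.inr (Set.mem_iUnion.2 ⟨0, Or.inl rfl⟩))

/-- The constant circuit is over `tcBasis`. [folklore] -/
theorem const_isOver_tcBasis (ι : Type*) (b : Bool) : (Circuit.const ι b).IsOver tcBasis := by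
  intro g hg
  simp only [Circuit.const, List.mem_singleton] at hg
  subst hg
  cases b
  · exact const_false_mem_tcBasis
  · exact const_true_mem_tcBasis

/-- **String circuits give matrix circuits (over `B₂`).** If `HAMCIRCUIT ∈ P/poly` then `HAM_m`
has polynomial-size matrix-input `B₂`-circuits: hard-wire the header of the code, read the
adjacency block off the matrix (one `∨₂` per off-diagonal entry, the constant `0` on the
diagonal), and run the string circuit of length `codeLen m`. [cite: AroraBarak2009, Def. 6.5 and §0.1] -/
theorem polySize_B2_of_mem_PPoly (h : HAMCIRCUIT ∈ PPoly) : PolySize B2 := by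
  obtain ⟨p, hp⟩ := Set.mem_iUnion.1 h
  obtain ⟨D, hD, hdec⟩ := hp
  -- size polynomial: `q + p ∘ q` with `q = X² + 2X + 4 ≥ codeLen`
  let q : Polynomial ℕ := X * X + 2 * X + 4
  have hq : ∀ m, codeLen m ≤ q.eval m := fun m => by
    simp only [q, eval_add, eval_mul, eval_X, eval_ofNat]
    exact codeLen_le m
  refine ⟨q + p.comp q, fun m => ?_⟩
  set N := codeLen m with hN
  have hcomp := (cktSize_codeBits m).comp (Circuit.cktSize_eval (D N) (hD N).1)
  -- the composite computes `HAM_m`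
  have hval : ∀ x : Fin m × Fin m → Bool,
      (D N).eval (fun j : Fin N => codeBit m j x) = hamFn m x := by
    intro x
    have h1 : (fun j : Fin N => codeBit m j x) =
        fun j : Fin N => (encodingGraph.encode ⟨m, grOf m x⟩)[(j : ℕ)]'(by
          rw [length_encode]; exact j.2) := funext fun j => codeBit_eq_getElem m j x
    rw [h1, eval_family_cast D _ (length_encode m (grOf m x)), hdec, boolIndicator_encode]
  obtain ⟨C, hCB, hCs, hCe⟩ := (hcomp.congr fun x _ => hval x).toCircuit
  refine ⟨C, hCB, hCs.trans ?_, hCe⟩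
  rw [eval_add, eval_comp]
  exact Nat.add_le_add (hq m) (((hD N).2).trans (natPoly_eval_mono p (hq m)))

/-- Matrix `B₂`-circuits give matrix `tcBasis`-circuits (`{∧₂, ∨₂, ¬} ⊆ tcBasis`, Jukna's
`12 s + 3` simulation of `B₂` by `{∧₂, ∨₂, ¬}`; at `m = 0` the constant circuit). [cite: Jukna2012, §1.2] -/
theorem polySize_tcBasis_of_polySize_B2 (h : PolySize B2) : PolySize tcBasis := by
  obtain ⟨p, hp⟩ := h
  refine ⟨12 * p + 3, fun m => ?_⟩
  obtain ⟨C, hCB, hCs, hCe⟩ := hp m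
  rcases Nat.eq_zero_or_pos m with rfl | hm
  · refine ⟨Circuit.const _ false, const_isOver_tcBasis _ false, ?_, fun x => ?_⟩
    · simp
    · rw [Circuit.eval_const, hamFn_zero]
  · obtain ⟨C', hB', hf', hs'⟩ := C.exists_deMorgan_of_B2 hCB (⟨0, hm⟩, ⟨0, hm⟩) hCe
    refine ⟨C', hB'.mono deMorganBasis_subset_tcBasis, hs'.trans ?_, hf'⟩
    simp only [eval_add, eval_mul, eval_ofNat]
    omega

/-! ### From matrix circuits over `tcBasis` to `B₂`-circuits on `Fin (m * m)` (Muroga) -/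

/-- "HAM has polynomial-size `B`-circuits on the linearised matrix `Fin (m * m)`". [folklore] -/
def PolySizeLin (B : Set GateFn) : Prop :=
  ∃ p : Polynomial ℕ, ∀ m : ℕ, ∃ C : Circuit (Fin (m * m)),
    C.IsOver B ∧ C.size ≤ p.eval m ∧
      C.Computes fun y => hamFn m fun q => y (finProdFinEquiv q)

/-- The threshold-gadget size of `TC0SubsetNC1.lean` (Muroga weights + carry-save addition).
[cite: Vollmer1999, Theorem 1.24] -/
noncomputable def gadgetSize (N : ℕ) : ℕ := N * 1 + wsumSize N (Nat.log 2 (N + 1).factorial + 1)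

/-- **Threshold circuits with few GATES are `B₂`-circuits with few gates** (on `Fin n` inputs):
a `tcBasis`-circuit with `s` gates on `n` inputs — whose majority gates may read wires with
arbitrary multiplicities, i.e. are arbitrary-weight thresholds of `≤ n + s` distinct wires — is
simulated by a `B₂`-circuit with `≤ s · (gadgetSize (n + s) + 1)` gates, by Muroga's weight bound
and iterated addition (the size half of `TC⁰ ⊆ NC¹`). [cite: Vollmer1999, §4.5.2 Cor. 4.35] -/
theorem exists_B2_of_tcBasis {n : ℕ} (C : Circuit (Fin n)) (hC : C.IsOver tcBasis) :
    ∃ C' : Circuit (Fin n), C'.IsOver B2 ∧ C'.size ≤ C.size * (gadgetSize (n + C.size) + 1) ∧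
      C'.Computes C.eval := by
  have h := Circuit.acRealOver_B2_of_tcBasis_of_gadget
    (fun N => 1 + wsumDepth N (Nat.log 2 (N + 1).factorial + 1)) gadgetSize
    (fun N M hM w θ => ncVec_threshold_logDepth N M hM w θ) C hC (le_refl (n + C.size))
  obtain ⟨C', hB, -, hs, hf⟩ := h.toCircuit
  exact ⟨C', hB, hs, hf⟩

/-- `gadgetSize` is polynomially bounded. [cite: Vollmer1999, Theorem 1.24] -/
theorem exists_poly_gadgetSize : ∃ q : Polynomial ℕ, ∀ N, gadgetSize N ≤ q.eval N :=
  threshold_gadget_size_bound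

/-- **Matrix `tcBasis`-circuits give linearised `B₂`-circuits of polynomial size.** [folklore] -/
theorem polySizeLin_B2_of_polySize_tcBasis (h : PolySize tcBasis) : PolySizeLin B2 := by
  obtain ⟨p, hp⟩ := h
  obtain ⟨g, hg⟩ := exists_poly_gadgetSize
  -- `N₁ = m² + |C₁| ≤ r m`, total `≤ p m · (g (r m) + 1)`
  let r : Polynomial ℕ := X * X + p
  refine ⟨p * (g.comp r + 1), fun m => ?_⟩
  obtain ⟨C, hCB, hCs, hCe⟩ := hp m
  -- A1: rewire the matrix circuit to the linearised inputs
  have h1 : CktSize tcBasis (fun (y : Fin (m * m) → Bool) (_ : Unit) =>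
      C.eval fun q => y (finProdFinEquiv q)) C.size :=
    (Circuit.cktSize_eval C hCB).rewire fun q => finProdFinEquiv q
  obtain ⟨C₁, h₁B, h₁s, h₁e⟩ := h1.toCircuit
  -- A2: Muroga simulation over `B₂`
  obtain ⟨C₂, h₂B, h₂s, h₂e⟩ := exists_B2_of_tcBasis C₁ h₁B
  refine ⟨C₂, h₂B, h₂s.trans ?_, fun y => ?_⟩
  · have hN : m * m + C₁.size ≤ r.eval m := by
      simp only [r, eval_add, eval_mul, eval_X]
      exact Nat.add_le_add_left (h₁s.trans hCs) _
    have hgad : gadgetSize (m * m + C₁.size) ≤ (g.comp r).eval m := by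
      rw [eval_comp]
      exact (hg _).trans (natPoly_eval_mono g hN)
    rw [eval_mul, eval_add, eval_one]
    exact Nat.mul_le_mul (h₁s.trans hCs) (Nat.succ_le_succ hgad)
  · rw [h₂e y, h₁e y, hCe]


/-! ### From linearised `B₂`-circuits to string circuits: `HAMCIRCUIT ∈ P/poly` -/

section Strings

variable (m : ℕ)

/-- `codeLen m = |hdr m| + m²` (definitional). [folklore] -/
theorem codeLen_eq : codeLen m = (hdr m).length + m * m := rfl

/-- The position of adjacency bit `k` in a code of length `codeLen m`. [folklore] -/
def blkPos (k : Fin (m * m)) : Fin (codeLen m) :=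
  ⟨(hdr m).length + k, by rw [codeLen_eq]; omega⟩

/-- The position of header bit `j`. [folklore] -/
def hdrPos (j : Fin (hdr m).length) : Fin (codeLen m) :=
  ⟨j, by rw [codeLen_eq]; omega⟩

/-- The adjacency block read off a bit vector of code length. [folklore] -/
def blk (s : Fin (codeLen m) → Bool) : Fin (m * m) → Bool := fun k => s (blkPos m k)

/-- Index type of the validity tests: header positions, ordered pairs (symmetry), vertices
(no loops). [folklore] -/
abbrev TestIdx (m : ℕ) : Type := Fin (hdr m).length ⊕ (Fin m × Fin m) ⊕ Fin m

/-- The validity tests of a purported code: the header is that of `m`, the adjacency block is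
symmetric, its diagonal is `0`. [folklore] -/
def test (s : Fin (codeLen m) → Bool) : TestIdx m → Bool
  | Sum.inl j => (s (hdrPos m j) == (hdr m)[(j : ℕ)])
  | Sum.inr (Sum.inl q) => (blk m s (finProdFinEquiv q) == blk m s (finProdFinEquiv (q.2, q.1)))
  | Sum.inr (Sum.inr u) => !blk m s (finProdFinEquiv (u, u))

/-- A bit vector of code length is VALID if it passes every test (then it is the code of a simple
graph on `m` vertices). [folklore] -/
def valid (s : Fin (codeLen m) → Bool) : Bool := decide (∀ t : TestIdx m, test m s t = true)

/-- The matrix read off a bit vector of code length. [folklore] -/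
def mat (s : Fin (codeLen m) → Bool) : Fin m × Fin m → Bool := fun q => blk m s (finProdFinEquiv q)

/-! #### Circuits for the tests -/

/-- Each test costs one `B₂` gate. [folklore] -/
theorem cktSize_test (t : TestIdx m) :
    CktSize B2 (fun (s : Fin (codeLen m) → Bool) (_ : Unit) => test m s t) 1 := by
  rcases t with j | q | u
  · exact (CktSize.gate (B := B2) ⟨1, fun v => (v 0 == (hdr m)[(j : ℕ)])⟩ (by show (1 : ℕ) ≤ 2; omega)
      fun _ => hdrPos m j).congr fun s _ => rfl
  · exact (CktSize.gate (B := B2) ⟨2, fun v => (v 0 == v 1)⟩ (by show (2 : ℕ) ≤ 2; omega)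
      ![blkPos m (finProdFinEquiv q), blkPos m (finProdFinEquiv (q.2, q.1))]).congr fun s _ => rfl
  · exact (cktSize_not (blkPos m (finProdFinEquiv (u, u)))).congr fun s _ => rfl

/-- The conjunction of `M` given bits costs `M + 1` gates over `B₂` (a chain of `∧₂`, seeded by
the constant `1`). [folklore] -/
theorem cktSize_all (M : ℕ) :
    CktSize B2 (fun (y : Fin M → Bool) (_ : Unit) => decide (∀ j, y j = true)) (M + 1) := by
  induction M with
  | zero => exact (cktSize_const _ true).congr fun y _ => by simp
  | succ M ih =>
    have h1 : CktSize B2 (fun (y : Fin (M + 1) → Bool) (_ : Unit) =>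
        decide (∀ j : Fin M, y (Fin.castSucc j) = true)) (M + 1) := ih.rewire Fin.castSucc
    have h2 := h1.pair (CktSize.proj B2 fun _ : Unit => Fin.last M)
    have h3 := h2.comp (cktSize_and (Sum.inl ()) (Sum.inr ()))
    refine (h3.congr fun y _ => ?_).of_le (by omega)
    simp only [Sum.elim_inl, Sum.elim_inr]
    have key : (∀ j : Fin (M + 1), y j = true) ↔
        (∀ j : Fin M, y (Fin.castSucc j) = true) ∧ y (Fin.last M) = true := Fin.forall_fin_succ'
    rw [show decide (∀ j : Fin (M + 1), y j = true) =
        decide ((∀ j : Fin M, y (Fin.castSucc j) = true) ∧ y (Fin.last M) = true) from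
      decide_eq_decide.2 key, Bool.decide_and, Bool.decide_eq_true]

/-- The conjunction of finitely many given bits costs `#κ + 1` gates over `B₂`. [folklore] -/
theorem cktSize_all_fintype (κ : Type*) [Fintype κ] :
    CktSize B2 (fun (y : κ → Bool) (_ : Unit) => decide (∀ k, y k = true)) (Fintype.card κ + 1) := by
  classical
  let e := Fintype.equivFin κ
  refine ((cktSize_all (Fintype.card κ)).rewire e.symm).congr fun y _ => ?_
  refine decide_eq_decide.2 ⟨fun h k => ?_, fun h j => h _⟩
  simpa using h (e k)

/-- The validity test costs `2 #TestIdx + 1` gates. [folklore] -/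
theorem cktSize_valid :
    CktSize B2 (fun (s : Fin (codeLen m) → Bool) (_ : Unit) => valid m s)
      (Fintype.card (TestIdx m) * 1 + (Fintype.card (TestIdx m) + 1)) :=
  ((CktSize.pi_const (B := B2) (κ := TestIdx m)
      (f := fun (s : Fin (codeLen m) → Bool) (t : TestIdx m) => test m s t) (s := 1)
      (cktSize_test m)).comp (cktSize_all_fintype (TestIdx m))).congr fun _ _ => rfl

/-- The number of tests: `|hdr m| + m² + m ≤ 2 · codeLen m`. [folklore] -/
theorem card_testIdx_le : Fintype.card (TestIdx m) ≤ 2 * codeLen m := by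
  simp only [TestIdx, Fintype.card_sum, Fintype.card_fin, Fintype.card_prod, codeLen_eq]
  nlinarith

/-- The string function of length `codeLen m`: valid AND the linearised HAM circuit accepts the
block. [folklore] -/
def strFn (C₂ : Circuit (Fin (m * m))) (s : Fin (codeLen m) → Bool) : Bool :=
  valid m s && C₂.eval (blk m s)

/-- Its circuit: tests, conjunction, the HAM circuit on the block, one `∧₂`. [folklore] -/
theorem cktSize_strFn (C₂ : Circuit (Fin (m * m))) (hB : C₂.IsOver B2) :
    CktSize B2 (fun (s : Fin (codeLen m) → Bool) (_ : Unit) => strFn m C₂ s)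
      (Fintype.card (TestIdx m) * 1 + (Fintype.card (TestIdx m) + 1) + C₂.size + 1) := by
  have h1 := (cktSize_valid m).pair ((Circuit.cktSize_eval C₂ hB).rewire (blkPos m))
  exact (h1.comp (cktSize_and (Sum.inl ()) (Sum.inr ()))).congr fun s _ => rfl

/-! #### Semantics of the tests -/

/-- Header bits of a code. [folklore] -/
theorem getElem_encode_hdrPos (G : SimpleGraph (Fin m)) (j : Fin (hdr m).length) :
    (encodingGraph.encode ⟨m, G⟩)[(hdrPos m j : ℕ)]'(by rw [length_encode]; exact (hdrPos m j).2) =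
      (hdr m)[(j : ℕ)] := by
  simp only [encode_eq, hdrPos]
  rw [List.getElem_append_left]

/-- Block bits of a code. [folklore] -/
theorem getElem_encode_blkPos (G : SimpleGraph (Fin m)) (k : Fin (m * m)) :
    (encodingGraph.encode ⟨m, G⟩)[(blkPos m k : ℕ)]'(by rw [length_encode]; exact (blkPos m k).2) =
      adjBlock G k := by
  simp only [encode_eq, blkPos]
  rw [List.getElem_append_right (by omega)]
  simp

open scoped Classical in
/-- The adjacency block of a graph at `(u, v)` is `[G.Adj u v]`. [folklore] -/
theorem adjBlock_apply (G : SimpleGraph (Fin m)) (u v : Fin m) :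
    adjBlock G (finProdFinEquiv (u, v)) = decide (G.Adj u v) := by
  simp [adjBlock]

/-- **Codes are valid.** [folklore] -/
theorem valid_encode (G : SimpleGraph (Fin m)) :
    valid m (fun j => (encodingGraph.encode ⟨m, G⟩)[(j : ℕ)]'(by rw [length_encode]; exact j.2)) = true := by
  classical
  unfold valid
  rw [decide_eq_true_eq]
  rintro (j | q | u)
  · simp only [test, getElem_encode_hdrPos, beq_self_eq_true]
  · obtain ⟨u, v⟩ := q
    simp only [test, blk, getElem_encode_blkPos, adjBlock_apply]
    rw [show decide (G.Adj v u) = decide (G.Adj u v) from decide_eq_decide.2 (G.adj_comm v u)]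
    exact beq_self_eq_true _
  · simp only [test, blk, getElem_encode_blkPos, adjBlock_apply]
    simp

/-- `blkPos` after `hdrPos`: every position is a header position or a block position. [folklore] -/
theorem pos_cases (j : Fin (codeLen m)) :
    (∃ j' : Fin (hdr m).length, j = hdrPos m j') ∨ ∃ k : Fin (m * m), j = blkPos m k := by
  by_cases h : (j : ℕ) < (hdr m).length
  · exact Or.inl ⟨⟨j, h⟩, Fin.ext rfl⟩
  · refine Or.inr ⟨⟨(j : ℕ) - (hdr m).length, ?_⟩, Fin.ext ?_⟩
    · have := j.2; have e := codeLen_eq m; omega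
    · simp only [blkPos]; omega

/-- **Valid bit vectors are codes**: a valid `s` is, bit by bit, the code of the graph of its
block. [folklore] -/
theorem encode_mat_of_valid {s : Fin (codeLen m) → Bool} (hv : valid m s = true) (j : Fin (codeLen m)) :
    (encodingGraph.encode ⟨m, grOf m (mat m s)⟩)[(j : ℕ)]'(by rw [length_encode]; exact j.2) = s j := by
  unfold valid at hv
  rw [decide_eq_true_eq] at hv
  rcases pos_cases m j with ⟨j', rfl⟩ | ⟨k, rfl⟩
  · have h := hv (Sum.inl j')
    simp only [test, beq_iff_eq] at h
    rw [getElem_encode_hdrPos, h]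
  · rw [getElem_encode_blkPos, adjBlock_grOf]
    set u := (finProdFinEquiv.symm k).1 with hu
    set v := (finProdFinEquiv.symm k).2 with hv'
    have hk : finProdFinEquiv (u, v) = k := by
      rw [hu, hv', Prod.mk.eta, Equiv.apply_symm_apply]
    by_cases huv : u = v
    · rw [if_pos huv]
      have h := hv (Sum.inr (Sum.inr u))
      simp only [test, Bool.not_eq_true'] at h
      rw [← huv] at hk
      rw [← hk]
      exact h.symm
    · rw [if_neg huv]
      have h := hv (Sum.inr (Sum.inl (u, v)))
      simp only [test, beq_iff_eq] at h
      show (blk m s (finProdFinEquiv (finProdFinEquiv.symm k)) || blk m s (finProdFinEquiv (v, u))) = blk m s k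
      rw [Equiv.apply_symm_apply, ← h, hk, Bool.or_self]

/-- **Semantics of the string circuit on strings of length `codeLen m`.** [cite: AroraBarak2009, Def. 6.5 and §0.1] -/
theorem strFn_eq_boolIndicator (C₂ : Circuit (Fin (m * m)))
    (hC : C₂.Computes fun y => hamFn m fun q => y (finProdFinEquiv q))
    (x : List Bool) (hx : x.length = codeLen m) :
    strFn m C₂ (fun j => x[(j : ℕ)]'(by rw [hx]; exact j.2)) = HAMCIRCUIT.boolIndicator x := by
  set s : Fin (codeLen m) → Bool := fun j => x[(j : ℕ)]'(by rw [hx]; exact j.2) with hs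
  by_cases hv : valid m s = true
  · -- `x` is the code of the graph of its block
    have hxe : x = encodingGraph.encode ⟨m, grOf m (mat m s)⟩ := by
      refine List.ext_getElem (by rw [hx, length_encode]) fun j h1 h2 => ?_
      have := encode_mat_of_valid m hv ⟨j, by rw [← hx]; exact h1⟩
      exact this.symm
    rw [strFn, hv, Bool.true_and, hC, hxe, boolIndicator_encode]
    rfl
  · -- `x` is not a code at all
    rw [strFn, Bool.eq_false_iff.2 hv, Bool.false_and]
    symm
    rw [← Bool.not_eq_true]
    intro hmem
    obtain ⟨⟨n', G'⟩, -, he⟩ := (Set.mem_iff_boolIndicator _ _).2 hmem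
    have hn : n' = m := by
      apply codeLen_strictMono.injective
      rw [← length_encode n' G', he, hx]
    subst hn
    apply hv
    convert valid_encode _ G' using 2
    funext j
    simp only [hs, he]

end Strings


/-! ### The circuit family deciding `HAMCIRCUIT` -/

/-- Transport of a circuit along an equality of input lengths: evaluation. [folklore] -/
theorem eval_transport {k n : ℕ} (E : Circuit (Fin k)) (h : k = n) (y : Fin n → Bool) :
    (h ▸ E).eval y = E.eval fun j => y (Fin.cast h j) := by
  subst h; rfl

/-- Transport of a circuit along an equality of input lengths: basis. [folklore] -/
theorem isOver_transport {k n : ℕ} (E : Circuit (Fin k)) (h : k = n) (B : Set GateFn) :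
    (h ▸ E).IsOver B ↔ E.IsOver B := by
  subst h; exact Iff.rfl

/-- Transport of a circuit along an equality of input lengths: size. [folklore] -/
theorem size_transport {k n : ℕ} (E : Circuit (Fin k)) (h : k = n) : (h ▸ E).size = E.size := by
  subst h; rfl

open scoped Classical in
/-- The circuit family: at a code length `codeLen m` the string circuit of `m`, elsewhere the
constant `0`. [cite: AroraBarak2009, Def. 6.2] -/
noncomputable def family (E : ∀ m, Circuit (Fin (codeLen m))) : CircuitFamily := fun n =>
  if h : ∃ m, codeLen m = n then h.choose_spec ▸ E h.choose else Circuit.const _ false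

/-- **Linearised `B₂`-circuits for HAM give `HAMCIRCUIT ∈ P/poly`.** At length `codeLen m` the
circuit checks that the input is a graph code with the header of `m` (symmetric block, empty
diagonal) and runs the HAM circuit on the block; other lengths carry no code. [cite: AroraBarak2009, Def. 6.5 and §0.1] -/
theorem mem_PPoly_of_polySizeLin_B2 (h : PolySizeLin B2) : HAMCIRCUIT ∈ PPoly := by
  obtain ⟨p, hp⟩ := h
  choose C hCB hCs hCe using hp
  let P : Polynomial ℕ := 4 * X + 3 + p
  -- the string circuit of each `m`
  have hstr : ∀ m, ∃ D : Circuit (Fin (codeLen m)), D.IsOver B2 ∧ D.size ≤ P.eval (codeLen m) ∧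
      ∀ (x : List Bool) (hx : x.length = codeLen m),
        D.eval (fun j => x[(j : ℕ)]'(by rw [hx]; exact j.2)) = HAMCIRCUIT.boolIndicator x := by
    intro m
    obtain ⟨D, hDB, hDs, hDe⟩ := (cktSize_strFn m (C m) (hCB m)).toCircuit
    refine ⟨D, hDB, hDs.trans ?_, fun x hx => ?_⟩
    · have h1 := card_testIdx_le m
      have h2 : (C m).size ≤ p.eval (codeLen m) := (hCs m).trans (natPoly_eval_mono p (le_codeLen m))
      simp only [P, eval_add, eval_mul, eval_ofNat, eval_X]
      omega
    · rw [hDe, strFn_eq_boolIndicator m (C m) (hCe m) x hx]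
  choose D hDB hDs hDe using hstr
  refine Set.mem_iUnion.2 ⟨P + 1, family D, fun n => ?_, fun x => ?_⟩
  · by_cases h : ∃ m, codeLen m = n
    · have hF : family D n = h.choose_spec ▸ D h.choose := dif_pos h
      rw [hF, isOver_transport, size_transport]
      refine ⟨hDB _, (hDs _).trans ?_⟩
      rw [h.choose_spec]
      simp only [P, eval_add, eval_one, eval_mul, eval_X, eval_ofNat]
      omega
    · have hF : family D n = Circuit.const _ false := dif_neg h
      rw [hF]
      exact ⟨const_isOver_B2 _ false, by simp⟩
  · by_cases h : ∃ m, codeLen m = x.length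
    · have hF : family D x.length = h.choose_spec ▸ D h.choose := dif_pos h
      rw [hF, eval_transport]
      exact hDe h.choose x h.choose_spec.symm
    · have hF : family D x.length = Circuit.const _ false := dif_neg h
      rw [hF, Circuit.eval_const]
      symm
      rw [← Bool.not_eq_true]
      intro hmem
      obtain ⟨⟨n', G'⟩, -, he⟩ := (Set.mem_iff_boolIndicator _ _).2 hmem
      exact h ⟨n', by rw [← he, length_encode]⟩

/-! ### Summary: the three forms of "HAM has small circuits" coincide with `NP ⊆ P/poly` -/

/-- **Matrix threshold circuits give `HAMCIRCUIT ∈ P/poly`** (Muroga + the code check). [cite: AroraBarak2009, Def. 6.5 and §0.1] -/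
theorem mem_PPoly_of_polySize_tcBasis (h : PolySize tcBasis) : HAMCIRCUIT ∈ PPoly :=
  mem_PPoly_of_polySizeLin_B2 (polySizeLin_B2_of_polySize_tcBasis h)

/-- **`HAMCIRCUIT ∈ P/poly` iff HAM has polynomial-size matrix-input threshold circuits**
(size = number of gates, arbitrary fan-in and multiplicities). [cite: AroraBarak2009, Def. 6.5 and §0.1] -/
theorem mem_PPoly_iff_polySize_tcBasis : HAMCIRCUIT ∈ PPoly ↔ PolySize tcBasis :=
  ⟨fun h => polySize_tcBasis_of_polySize_B2 (polySize_B2_of_mem_PPoly h), mem_PPoly_of_polySize_tcBasis⟩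

/-- The same over `B₂`. [cite: AroraBarak2009, Def. 6.5 and §0.1] -/
theorem mem_PPoly_iff_polySize_B2 : HAMCIRCUIT ∈ PPoly ↔ PolySize B2 :=
  ⟨polySize_B2_of_mem_PPoly, fun h => mem_PPoly_of_polySize_tcBasis (polySize_tcBasis_of_polySize_B2 h)⟩

/-- **`NP ⊆ P/poly` iff HAM has polynomial-size matrix-input threshold circuits** (Karp:
`HAMILTON CIRCUIT` is NP-complete, proved in the tree; `P/poly` is closed under Karp reductions). [cite: Karp1972, §4 Main Theorem problem 10] -/
theorem np_subset_PPoly_iff_polySize_tcBasis : Nondeterministic.NP ⊆ PPoly ↔ PolySize tcBasis :=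
  (NP_subset_PPoly_iff_of_isNPComplete isNPComplete_HAMCIRCUIT_holds).trans mem_PPoly_iff_polySize_tcBasis


open scoped Classical in
/-- **`NP ⊆ P/poly` iff Hamiltonicity of `m`-vertex graphs, read off the `m × m` Boolean matrix,
has threshold circuits with polynomially many gates at every `m`** — the matrix form used by the
symmetric-circuit routes, spelled out. [cite: AroraBarak2009, §6.4] -/
theorem np_subset_PPoly_iff_matrixCircuits :
    Nondeterministic.NP ⊆ PPoly ↔
      ∃ p : Polynomial ℕ, ∀ m : ℕ, ∃ C : Circuit (Fin m × Fin m),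
        C.IsOver tcBasis ∧ C.size ≤ p.eval m ∧
          C.Computes fun x : Fin m × Fin m → Bool =>
            decide (SimpleGraph.fromRel fun u v => x (u, v) = true : SimpleGraph (Fin m)).IsHamiltonian :=
  np_subset_PPoly_iff_polySize_tcBasis

open scoped Classical in
/-- The same for `HAMCIRCUIT ∈ P/poly`. [cite: AroraBarak2009, Def. 6.5 and §0.1] -/
theorem mem_PPoly_iff_matrixCircuits :
    HAMCIRCUIT ∈ PPoly ↔
      ∃ p : Polynomial ℕ, ∀ m : ℕ, ∃ C : Circuit (Fin m × Fin m),
        C.IsOver tcBasis ∧ C.size ≤ p.eval m ∧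
          C.Computes fun x : Fin m × Fin m → Bool =>
            decide (SimpleGraph.fromRel fun u v => x (u, v) = true : SimpleGraph (Fin m)).IsHamiltonian :=
  mem_PPoly_iff_polySize_tcBasis


end HamMatrix

end Literature.Computability.Complexity
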